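import Summits.NavierStokesRegularity.NavierStokesRegularity.Theorems.WakeRatchetEternalViscousRateLeakRatchetVisc
import Summits.NavierStokesRegularity.NavierStokesRegularity.Theorems.WakeRatchetEternalInviscidRateOfActionBudget

/-!
# Crux `WakeRatchet.EternalViscousRate` (⟨stmt-NavierStokesRegularity-25647⟩, K1ᵛ RATE, the dissipation-balanced slice) BY NAME
# from the SAME uniform action budget as its inviscid sibling — and BOTH rate cruxes from ONE hypothesis over all `ν̂ ≥ 0`

The landed viscous leak ratchet (`DissipationEdge.tail_succ_le_leak_envelope_visc`, p817499; any covariant viscosity `ν̂ ≥ 0`, any `m`)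
has the crux's shape with the solution-dependent factor `1 − e^{−2C_AΛ⁻¹A_{n+1}}`.  Hence, exactly as for the inviscid sibling
(`FinalWakeLedger.EternalInviscidRate_of_actionBudget`):
* `EternalViscousRate_of_actionBudget` — **the crux BY NAME** from the UNIFORM ACTION BUDGET
  `2C_AΛ⁻¹·∫_ℝ‖W_n‖ ≤ −log(1 − (1+ε₀)^{−a})` over the uniformly bounded admissible eternal solutions with `ν̂ > 0` of the `E₂(R)` tables.
* `EternalViscousRate_of_logAction` — the same from a LOG-ACTION bound `θ·log(1/ε₀)`, `θ < 1` (`a = 2`).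
* `rateCruxes_of_actionBudget` — ONE budget over ALL `ν̂ ≥ 0` (`IsEternalVisc ε₀ ν̂`, which at `ν̂ = 0` is `IsEternal`) gives BOTH children
  `EternalInviscidRate ∧ EternalViscousRate` of the route's repaired deciding crux `TailRateRatchet` (⟨25584⟩; its split glue ⟨25648⟩ is proved).
READING (census).  The open registered stub `stub_inertial` of ⟨25647⟩'s skeleton 842b1374 is the crux's `ν̂ = 1` slice in the inertial regime
and is FALSE modulo the construction `ViscousBlockDSSWaves` (p608789); this file does not touch that: it records that on BOTH children the only
thing the rate needs beyond the kernel-certified leak mechanism is an `O(log(1/ε₀))` effective action per shell, uniformly on `E₂(R)`.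
MODEL lattice only (Tao 2016 §4 renormalised cascade with the covariant viscous coefficient); nothing here is a statement about the
Navier–Stokes equations; no registered stub is closed by this file; no summit is proved by it.
[cite: Tao2016AveragedNS, §4 Lemma 4.1 (4.8)–(4.10) with the cancellation (4.3), the viscous equation before Thm. 4.2, §6.4]
-/

noncomputable section

set_option linter.dupNamespace false

open Filter Topology Set MeasureTheory
open Literature.Analysis.FluidPDE Literature.Analysis.FluidPDE.TaoCascade
open Summit.NavierStokesRegularity.NavierStokesRegularity.Theorems
open Summit.NavierStokesRegularity.NavierStokesRegularity.Cruxes.EternalInviscidRate.FinalWakeLedger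

namespace Summit.NavierStokesRegularity.NavierStokesRegularity.Cruxes.EternalViscousRate.DissipationEdge

/-- **K1ᵛ RATE BY NAME from the UNIFORM ACTION BUDGET.**  If for every spread `R ≥ 1` there are `a > 1` and `εs > 0` such that for all
`0 < ε₀ ≤ εs`, every table of `E₂(R)`, every `ν̂ > 0`, every uniformly bounded admissible eternal solution `W` with covariant viscosity `ν̂`
and every shell `n`, `2·C_A·Λ⁻¹·∫_ℝ ‖W_n‖ ≤ −log(1 − (1+ε₀)^{−a})`, then `WakeRatchet.EternalViscousRate` holds (same `a`, `εs`).
MODEL lattice only.  [cite: Tao2016AveragedNS, §4 Lemma 4.1 (4.8)–(4.10), (4.3), the viscous equation before Thm. 4.2, §6.4] -/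
theorem EternalViscousRate_of_actionBudget
    (h : ∀ R : ℝ, 1 ≤ R → ∃ a : ℝ, 1 < a ∧ ∃ εs : ℝ, 0 < εs ∧ ∀ ε₀ : ℝ, 0 < ε₀ → ε₀ ≤ εs →
      ∀ α : Fin 4 → Fin 4 → Fin 4 → ℤ × ℤ × ℤ → ℝ, InTableClass R α →
      ∀ (νh : ℝ) (W : ℤ → ℝ → Em 4), 0 < νh → IsEternalVisc ε₀ νh α W → UniformBound W →
      ∀ n : ℤ, 2 * fluxConst α * (bigLam ε₀)⁻¹ * ∫ σ, ‖W n σ‖ ≤ -Real.log (1 - (1 + ε₀) ^ (-a))) :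
    Summit.NavierStokesRegularity.NavierStokesRegularity.Theses.WakeRatchet.EternalViscousRate := by
  intro R hR
  obtain ⟨a, ha, εs, hεs, H⟩ := h R hR
  refine ⟨a, ha, εs, hεs, ?_⟩
  intro ε₀ hε₀ hle α hα νh W hν hW hU n M hM σ
  have hc : IsCancellingCoeff α := hα.2.1
  obtain ⟨Mact, hact⟩ := hW.action
  have key := tail_succ_le_leak_envelope_visc hε₀ hc hW hU n hM (hact (n + 1)).1 le_rfl σ
  have h1ε : 1 < 1 + ε₀ := by linarith
  have hqlt : (1 + ε₀) ^ (-a) < 1 := Real.rpow_lt_one_of_one_lt_of_neg h1ε (by linarith)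
  have hupos : 0 < 1 - (1 + ε₀) ^ (-a) := by linarith
  have hB := H ε₀ hε₀ hle α hα νh W hν hW hU (n + 1)
  have hexp : 1 - (1 + ε₀) ^ (-a) ≤
      Real.exp (-(2 * fluxConst α * (bigLam ε₀)⁻¹ * ∫ σ, ‖W (n + 1) σ‖)) := by
    calc 1 - (1 + ε₀) ^ (-a) = Real.exp (Real.log (1 - (1 + ε₀) ^ (-a))) := (Real.exp_log hupos).symm
      _ ≤ Real.exp (-(2 * fluxConst α * (bigLam ε₀)⁻¹ * ∫ σ, ‖W (n + 1) σ‖)) :=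
          Real.exp_le_exp.mpr (by linarith)
  have hM0 : 0 ≤ M := (tsum_nonneg fun k => physEnergy_nonneg _ _ _ _).trans (hM σ)
  calc ∑' k : ℕ, physEnergy ε₀ W (n + 1 + k) σ
      ≤ (1 - Real.exp (-(2 * fluxConst α * (bigLam ε₀)⁻¹ * ∫ σ, ‖W (n + 1) σ‖))) * M := key
    _ ≤ (1 + ε₀) ^ (-a) * M := mul_le_mul_of_nonneg_right (by linarith) hM0

/-- **K1ᵛ RATE BY NAME from a LOG-ACTION bound** `2·C_A·Λ⁻¹·∫_ℝ ‖W_n‖ ≤ θ·log(1/ε₀)`, `θ = θ(R) < 1`, over the bounded admissible eternal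
solutions with `ν̂ > 0` of the `E₂(R)` tables (conclusion with `a = 2`, `εs' = min εs (min (1/4) 2^{−1/(1−θ)})`).  MODEL lattice only.
[cite: Tao2016AveragedNS, §4 Lemma 4.1 (4.8)–(4.10), (4.3), the viscous equation before Thm. 4.2, §6.4] -/
theorem EternalViscousRate_of_logAction
    (h : ∀ R : ℝ, 1 ≤ R → ∃ θ : ℝ, θ < 1 ∧ ∃ εs : ℝ, 0 < εs ∧ ∀ ε₀ : ℝ, 0 < ε₀ → ε₀ ≤ εs →
      ∀ α : Fin 4 → Fin 4 → Fin 4 → ℤ × ℤ × ℤ → ℝ, InTableClass R α →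
      ∀ (νh : ℝ) (W : ℤ → ℝ → Em 4), 0 < νh → IsEternalVisc ε₀ νh α W → UniformBound W →
      ∀ n : ℤ, 2 * fluxConst α * (bigLam ε₀)⁻¹ * ∫ σ, ‖W n σ‖ ≤ θ * Real.log (1 / ε₀)) :
    Summit.NavierStokesRegularity.NavierStokesRegularity.Theses.WakeRatchet.EternalViscousRate := by
  refine EternalViscousRate_of_actionBudget fun R hR => ?_
  obtain ⟨θ, hθ, εs, hεs, H⟩ := h R hR
  set ε₁ : ℝ := (2 : ℝ) ^ (-(1 / (1 - θ))) with hε₁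
  have hε₁pos : 0 < ε₁ := Real.rpow_pos_of_pos (by norm_num) _
  refine ⟨2, by norm_num, min εs (min (1 / 4) ε₁), lt_min hεs (lt_min (by norm_num) hε₁pos), ?_⟩
  intro ε₀ hε₀ hle α hα νh W hν hW hU n
  have hleεs : ε₀ ≤ εs := hle.trans (min_le_left _ _)
  have hle4 : ε₀ ≤ 1 / 4 := hle.trans ((min_le_right _ _).trans (min_le_left _ _))
  have hleε₁ : ε₀ ≤ ε₁ := hle.trans ((min_le_right _ _).trans (min_le_right _ _))
  have hB := H ε₀ hε₀ hleεs α hα νh W hν hW hU n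
  have h1θ : 0 < 1 - θ := by linarith
  have hlogε : Real.log ε₀ ≤ -(1 / (1 - θ)) * Real.log 2 := by
    have := Real.log_le_log hε₀ hleε₁
    rwa [hε₁, Real.log_rpow (by norm_num : (0 : ℝ) < 2)] at this
  have hlog2 : Real.log 2 ≤ (1 - θ) * Real.log (1 / ε₀) := by
    rw [one_div, Real.log_inv]
    have h' : (1 - θ) * Real.log ε₀ ≤ (1 - θ) * (-(1 / (1 - θ)) * Real.log 2) :=
      mul_le_mul_of_nonneg_left hlogε h1θ.le
    have h'' : (1 - θ) * (-(1 / (1 - θ)) * Real.log 2) = -Real.log 2 := by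
      field_simp
    linarith
  have hstep : θ * Real.log (1 / ε₀) ≤ -Real.log (2 * ε₀) := by
    rw [Real.log_mul (by norm_num) hε₀.ne', one_div, Real.log_inv] at *
    linarith
  have hcal := neg_log_one_sub_rpow_neg_two_ge hε₀ (by linarith)
  calc 2 * fluxConst α * (bigLam ε₀)⁻¹ * ∫ σ, ‖W n σ‖ ≤ θ * Real.log (1 / ε₀) := hB
    _ ≤ -Real.log (2 * ε₀) := hstep
    _ ≤ -Real.log (1 - (1 + ε₀) ^ (-(2 : ℝ))) := hcal

/-- **BOTH RATE CRUXES from ONE budget over all `ν̂ ≥ 0`.**  A uniform action budget `2·C_A·Λ⁻¹·∫_ℝ‖W_n‖ ≤ −log(1 − (1+ε₀)^{−a})` over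
every uniformly bounded admissible eternal solution of covariant viscosity `ν̂ ≥ 0` (`IsEternalVisc ε₀ ν̂`; `ν̂ = 0` is `IsEternal`) of every
`E₂(R)` table, all small `ε₀`, yields `EternalInviscidRate ∧ EternalViscousRate` — the two children of the deciding crux `TailRateRatchet`.
MODEL lattice only.  [cite: Tao2016AveragedNS, §4 Lemma 4.1 (4.8)–(4.10), (4.3), the viscous equation before Thm. 4.2, §6.4] -/
theorem rateCruxes_of_actionBudget
    (h : ∀ R : ℝ, 1 ≤ R → ∃ a : ℝ, 1 < a ∧ ∃ εs : ℝ, 0 < εs ∧ ∀ ε₀ : ℝ, 0 < ε₀ → ε₀ ≤ εs →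
      ∀ α : Fin 4 → Fin 4 → Fin 4 → ℤ × ℤ × ℤ → ℝ, InTableClass R α →
      ∀ (νh : ℝ) (W : ℤ → ℝ → Em 4), 0 ≤ νh → IsEternalVisc ε₀ νh α W → UniformBound W →
      ∀ n : ℤ, 2 * fluxConst α * (bigLam ε₀)⁻¹ * ∫ σ, ‖W n σ‖ ≤ -Real.log (1 - (1 + ε₀) ^ (-a))) :
    Summit.NavierStokesRegularity.NavierStokesRegularity.Theses.WakeRatchet.EternalInviscidRate ∧
      Summit.NavierStokesRegularity.NavierStokesRegularity.Theses.WakeRatchet.EternalViscousRate := by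
  constructor
  · refine EternalInviscidRate_of_actionBudget fun R hR => ?_
    obtain ⟨a, ha, εs, hεs, H⟩ := h R hR
    exact ⟨a, ha, εs, hεs, fun ε₀ hε₀ hle α hα W hW hU n =>
      H ε₀ hε₀ hle α hα 0 W le_rfl hW.isEternalVisc hU n⟩
  · refine EternalViscousRate_of_actionBudget fun R hR => ?_
    obtain ⟨a, ha, εs, hεs, H⟩ := h R hR
    exact ⟨a, ha, εs, hεs, fun ε₀ hε₀ hle α hα νh W hν hW hU n =>
      H ε₀ hε₀ hle α hα νh W hν.le hW hU n⟩

end Summit.NavierStokesRegularity.NavierStokesRegularity.Cruxes.EternalViscousRate.DissipationEdge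

end
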